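import Summits.BirchSwinnertonDyer.BirchSwinnertonDyer.Theses.PrintX8
import Summits.BirchSwinnertonDyer.BirchSwinnertonDyer.Theorems.SignedLowerHalvesSprungLowerDivisibilityAtThreeSurjBranch
import HarnessLib

/-!
# Route `PrintX8`, support item `GlueMainConjectureX8` (stmt-BirchSwinnertonDyer-20404): the C1
# decomposition K1 → small-image crux → published inputs → C1, PROVED (cell `bsd-print-x8`,
# D-0131 (2) print tier, prover seat p2; `--workitem` 20404)

PARTITION (cell bsd-print-x8, leaf `ClassX8` = K3 row A8; 217 census cells = 156 with `ρ̄_{E,3}` onto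
+ 61 with image the normaliser of a non-split Cartan): closes the GLUE item 20404 (pure composition);
0 census moves; BSD is not proved by any of this.

HONEST FRAMING. Route `PrintX8` (rev 3) derives its one residual C1 `SharpFlatMainConjectureX8`
(Sprung's ♯/♭ Main Conjecture 7.21 on every X8 pair of analytic rank `≤ 1`, both colours) from
* K1 = `SprungLowerDivisibilityAtThree` (item stmt-BirchSwinnertonDyer-19875, shared BY NAME with route
  `SignedLowerHalves`: the Eisenstein half on ALL X8 pairs — OPEN, beyond print),
* the NEW small-image crux `SharpFlatMainConjectureSmallImageX8` (item 20402: the 61 cells where Kato's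
  half is only rational — OPEN, beyond print, no engine even PRE), and
* `PublishedInputsX8` (item 20403: eight named facts; here only conjuncts 4, 5, 7 are consumed —
  Sprung 2012 Thm. 7.14 `thm714_…`, Thm. 7.16 `thm716_…` (Kato's half, flag `Sp12-716-period`), the
  period unit at `3` `realPeriodRat_eq_unit_mul_plusPeriod_three`),
through the glue item `GlueMainConjectureX8 := K1 → SmallImage → PublishedInputsX8 → C1`. This file
PROVES that glue (`glueMainConjectureX8_holds`): case split on `Surj W 3`; on the big-image branch seat
p2's landed RANK-FREE squeeze `Theorems.X8.sprungSharpFlatMainConjecture_of_lowerDivisibility_of_surj`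
(p534029: K1• + Kato integral under `surj(3)` by Wuthrich 2014 Lemma 20, a kernel theorem, + torsion +
period unit ⇒ `(gen) = (L^•)` by `Λ`-rigidity); off it the small-image crux verbatim. Also recorded
(route types): C1 on `surj(3)` ⟸ K1 (`sharpFlatMainConjectureX8_surj_of_K1`), C1 ⟺ (C1 on `surj(3)`)
∧ SmallImage (`sharpFlatMainConjectureX8_iff_surj_and_smallImage`), and the converse edges C1 ⇒
SmallImage, C1 ⇒ K1's predicate on `surj(3) ∧ r_an ≤ 1` — so modulo the three published inputs the
route's residual C1 EQUALS «K1 on the 156 big-image cells (r ≤ 1)» ∧ «MC on the 61 small-image cells».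
Beyond-print theorem: NO (this file is composition); K1 and SmallImage: YES.

References: [Sprung2012] Thm. 7.14, Thm. 7.16, Main Conj. 1.3 / 7.21 (pp. 1486, 1504–1505);
[Wuthrich2014] Lemma 20 (p. 399); route file `Theses/PrintX8.lean` rev 3; p534029.
-/

set_option autoImplicit false
-- justification: the mandated namespace `Summit.BirchSwinnertonDyer.BirchSwinnertonDyer.Theorems`
-- (single-conjunct summit, Sub = Summit) repeats a segment by design (D-0017).
set_option linter.dupNamespace false

noncomputable section

open scoped Classical
open WeierstrassCurve Literature.NumberTheory.EllipticCurves
  Literature.NumberTheory.EllipticCurves.Rank1Residual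
  Literature.NumberTheory.EllipticCurves.Sprung2017 Literature.NumberTheory.EllipticCurves.Sprung2012
  Summit.BirchSwinnertonDyer.BirchSwinnertonDyer.Theses.PrintX8

namespace Summit.BirchSwinnertonDyer.BirchSwinnertonDyer.Theorems.PrintX8MainConjectureSplit

/-- **C1 on the big-image branch ⟸ K1 BY NAME** (route types): granted Sprung 2012 Thms. 7.14 / 7.16
and the period unit at `3`, K1 `SprungLowerDivisibilityAtThree` gives Sprung's Main Conjecture at every
X8 pair of analytic rank `≤ 1` with `ρ̄_{E,3}` surjective, both colours — by p2's rank-free squeeze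
(p534029). [cite: Sprung2012, Thm. 7.14, Thm. 7.16 and Main Conj. 7.21 (pp. 1504–1505)] [cite: Wuthrich2014, Lemma 20 (p. 399)] -/
theorem sharpFlatMainConjectureX8_surj_of_K1
    (h714 : thm714_sharpFlatSelmerDual_finite_torsion)
    (h716 : thm716_sharpFlatCharIdeal_divisibility)
    (h3 : realPeriodRat_eq_unit_mul_plusPeriod_three)
    (hK1 : SprungLowerDivisibilityAtThree) :
    ∀ (W : WeierstrassCurve ℚ) [W.IsElliptic] [W.IsGloballyMinimal] (p : ℕ) [Fact p.Prime],
      ClassX8 W p → Surj W p → W.analyticRank ≤ 1 →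
        ∀ col : Chroma, SprungSharpFlatMainConjecture W p col :=
  fun W _ _ p _ hX hs _ col ↦
    X8.sprungSharpFlatMainConjecture_of_lowerDivisibility_of_surj h714 h716 h3 W p hX hs col
      (hK1 W p hX col)

/-- **`GlueMainConjectureX8` HOLDS** (item stmt-BirchSwinnertonDyer-20404): K1 → the small-image crux
→ the published inputs → C1. Case split on `Surj W p`: surjective ⇒ `sharpFlatMainConjectureX8_surj_of_K1`
with conjuncts 4, 5, 7 of `PublishedInputsX8`; non-surjective ⇒ the small-image crux verbatim.
[cite: Sprung2012, Thm. 7.14, Thm. 7.16 and Main Conj. 7.21 (pp. 1504–1505)] [cite: Wuthrich2014, Lemma 20 (p. 399)] -/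
theorem glueMainConjectureX8_holds : GlueMainConjectureX8 := by
  intro hK1 hSmall hPub W _ _ p _ hX hr col
  obtain ⟨-, -, -, h714, h716, -, h3, -⟩ := hPub
  by_cases hs : Surj W p
  · exact sharpFlatMainConjectureX8_surj_of_K1 h714 h716 h3 hK1 W p hX hs hr col
  · exact hSmall W p hX hs hr col

/-- **C1 ⟺ (C1 on `surj(3)`) ∧ (the small-image crux)** — pure logic over the two image branches
(156 + 61 census cells). [cite: Sprung2012, Main Conj. 7.21 (p. 1505)] -/
theorem sharpFlatMainConjectureX8_iff_surj_and_smallImage :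
    SharpFlatMainConjectureX8 ↔
      ((∀ (W : WeierstrassCurve ℚ) [W.IsElliptic] [W.IsGloballyMinimal] (p : ℕ) [Fact p.Prime],
          ClassX8 W p → Surj W p → W.analyticRank ≤ 1 →
            ∀ col : Chroma, SprungSharpFlatMainConjecture W p col) ∧
        SharpFlatMainConjectureSmallImageX8) := by
  unfold SharpFlatMainConjectureX8 SharpFlatMainConjectureSmallImageX8
  refine ⟨fun h ↦ ⟨fun W _ _ p _ hX _ hr col ↦ h W p hX hr col, fun W _ _ p _ hX _ hr col ↦ h W p hX hr col⟩,
    fun ⟨h1, h2⟩ W _ _ p _ hX hr col ↦ ?_⟩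
  by_cases hs : Surj W p
  · exact h1 W p hX hs hr col
  · exact h2 W p hX hs hr col

/-- **C1 ⟺ the small-image crux, GRANTED K1 and the published inputs**: modulo item 19875 and
conjuncts 4, 5, 7 of `PublishedInputsX8`, the route's residual C1 is EXACTLY the 61-cell small-image
statement. [cite: Sprung2012, Thm. 7.14, Thm. 7.16 and Main Conj. 7.21 (pp. 1504–1505)] -/
theorem sharpFlatMainConjectureX8_iff_smallImage_of_K1
    (h714 : thm714_sharpFlatSelmerDual_finite_torsion)
    (h716 : thm716_sharpFlatCharIdeal_divisibility)
    (h3 : realPeriodRat_eq_unit_mul_plusPeriod_three)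
    (hK1 : SprungLowerDivisibilityAtThree) :
    SharpFlatMainConjectureX8 ↔ SharpFlatMainConjectureSmallImageX8 :=
  ⟨fun h ↦ (sharpFlatMainConjectureX8_iff_surj_and_smallImage.mp h).2,
    fun h ↦ sharpFlatMainConjectureX8_iff_surj_and_smallImage.mpr
      ⟨sharpFlatMainConjectureX8_surj_of_K1 h714 h716 h3 hK1, h⟩⟩

/-- **Converse edge: C1 ⇒ K1's predicate on `surj(3) ∧ r_an ≤ 1`** (the leaf's own edge `MC ⇒
Eisenstein half`), so on the big-image branch in analytic rank `≤ 1` the route's C1 and the shared crux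
K1 COINCIDE modulo the three published inputs (K1's further content: analytic rank `≥ 2`, and the
Eisenstein half on the small-image pairs). [cite: Sprung2012, Main Conj. 1.3 (p. 1486) and Main Conj. 7.21 (p. 1505)] -/
theorem sprungLowerDivisibility_surj_rankLeOne_of_sharpFlatMainConjectureX8
    (h : SharpFlatMainConjectureX8) :
    ∀ (W : WeierstrassCurve ℚ) [W.IsElliptic] [W.IsGloballyMinimal] (p : ℕ) [Fact p.Prime],
      ClassX8 W p → Surj W p → W.analyticRank ≤ 1 →
        ∀ col : Chroma, SprungSharpFlatLowerDivisibility W p col :=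
  fun W _ _ p _ hX _ hr col ↦ sprungSharpFlatLowerDivisibility_of_mainConjecture (h W p hX hr col)

end Summit.BirchSwinnertonDyer.BirchSwinnertonDyer.Theorems.PrintX8MainConjectureSplit

end
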